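import Literature.Geometry.Lorentzian.CoordShrinkerRicciPinching
import Literature.Geometry.Lorentzian.CoordShrinkerRicciNormSqDrift
import Literature.Geometry.Lorentzian.CoordShrinkerCurvatureGradientBound
import Literature.Geometry.Riemannian.ShrinkerPotentialProper
import Literature.Geometry.Riemannian.GradientSolitonIdentities
import Literature.Geometry.Riemannian.BakryEmeryHeatFlow
import Literature.Geometry.Riemannian.ShrinkerScalarCurvatureNonnegHolds
import Literature.Geometry.Lorentzian.RicciNormSq
import Literature.Geometry.Riemannian.CurvatureDerivativeNormSq
import HarnessLib

/-!
# Munteanu–Wang 2015, Prop. 1.3 / Thm. 1.4: on a complete four-dimensional gradient shrinker with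
# bounded scalar curvature, `|Ric|` and `|Rm|` are bounded — the assembly, modulo registered inputs

**Theorem** (O. Munteanu, J. Wang, *Geometry of shrinking Ricci solitons*, Compositio Math. 151
(2015), Prop. 1.3 and Thm. 1.4, p. 6: "Let `(M, g, f)` be a four dimensional shrinking Ricci soliton
with bounded scalar curvature `S ≤ A`. Then the Riemann curvature tensor and its covariant derivative
are bounded in norm as well"). This file ASSEMBLES the first half (`|Ric|`, `|Rm|` bounded; `|∇Rm|` is
not treated) on a complete connected four-manifold from pointwise coordinate inequalities and a
localised maximum principle, for a normalised shrinker `Ric + Hess f = ½ g`, `R + |∇f|² = f`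
(closed `g`-balls compact):

* `normSq_ricci_chartInv_eq`, `curvNormSqWith_chartInv_eq`, `contMDiff_curvNormSqWith` — the chart
  dictionary for `|Ric|²_g` and `|Rm|²_g = g.curvNormSqWith g.leviCivita` and the smoothness of the
  latter;
* `normSq_ricci_bounded_of` — **Prop. 1.3: `|Ric|²_g ≤ C`**, from the pointwise drift inequality for
  `u = |Ric|²(S+1)^{-1/2}` (`IsMetricOn.mw_drift_normSqAt_ricAt_mul_profile`,
  `CoordShrinkerRicciPinching.lean`, fed by Prop. 1.1 `IsMetricOn.gradSqAt_mul_rmNormSqAt_le_of_soliton`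
  and (1.10) `IsMetricOn.lapAt_normSqAt_ricAt_sub_fderiv_ge_of_shrinker`) read in the chart at every
  point with `f ≥ 768(A+1) + A` (`dalembertian_chartInv_eq`, `innerDual_chartInv_eq`,
  `gradSq_chartInv_eq`, `scalarCurvature_chartInv_eq`), the properness of `f`
  (`Shrinker.isCompact_potential_le`), `R ≥ 0` (`shrinkerScalarCurvature_nonneg_holds`) and the
  localised maximum principle on the shrinker, taken as the HYPOTHESIS `hS9` (= the registered stub
  `helper_mwShrinkerMaxPrinciple` of crux `EntropyRung.NoncompactShrinkerGap`, SmoothPoincare4);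
* `curvNormSq_bounded_of` — **Thm. 1.4 (first half): `|Rm|²_g ≤ C`**, from the Ricci bound, the
  pointwise drift inequality for `v = √(|Rm|²+1) + |Ric|²` and the `Rm`-equation, taken as the
  HYPOTHESES `hS11`, `hS5` (registered stubs `helper_mwRmDriftChart`, `helper_mwRmNormSqDrift`), and `hS9`.

The unconditional theorems follow by `exact` once the three registered inputs land (sibling file
`FourShrinkerCurvatureBounded.lean`). This is step 1 of the printed chain behind the named fact
`shrinkerSplittingAtInfinity_four` (`ShrinkerSplittingAtInfinity.lean`). Everything is proved; no
definition and no statement of `Prop` type is introduced.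

## References

* O. Munteanu, J. Wang, *Geometry of shrinking Ricci solitons*, Compositio Math. 151 (2015)
  2273–2300 = arXiv:1410.3813, §1: Prop. 1.1, Lemma 1.2, Prop. 1.3, Thm. 1.4 (pp. 4–6). READ.
  [MunteanuWang2015]
* P. Topping, *Lectures on the Ricci flow*, LMS Lecture Note Series 325, CUP 2006, §3.2, (3.2.4)
  (`|Rm|²`). [Topping2006]
* B. O'Neill, *Semi-Riemannian geometry with applications to relativity*, Academic Press 1983, Ch. 3,
  Prop. 3.59 (naturality). [ONeill1983]
-/

noncomputable section

set_option maxSynthPendingDepth 3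

open Set Filter Module Metric
open scoped Manifold ContDiff Topology NNReal ENNReal

namespace Literature.Geometry.Riemannian

open Lorentzian Lorentzian.PseudoRiemannianMetric

namespace FourShrinker

variable {M : Type} [TopologicalSpace M] [T2Space M] [SecondCountableTopology M]
  [ChartedSpace (EuclideanSpace ℝ (Fin 4)) M] [IsManifold (𝓡 4) ∞ M] [ConnectedSpace M]
  [T3Space M] [MeasurableSpace M] [BorelSpace M]
  (g : PseudoRiemannianMetric (𝓡 4) ∞ (EuclideanSpace ℝ (Fin 4)) (TangentSpace (𝓡 4) : M → Type _))
  [g.HasLeviCivita] (f : M → ℝ)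

omit [T2Space M] [SecondCountableTopology M] [ConnectedSpace M] [T3Space M] [MeasurableSpace M]
  [BorelSpace M] in
/-- **`|Ric|²` read in the chart** at any point of the chart target: `|Ric|²_g(Φ u) = |ricAt G|²_G(u)`
(`normSq_chartPullback_eq`, `ricci_comap_apply`, `OpensChart.normSq_ricci_eq_normSqAt`).
[cite: ONeill1983, Ch. 3, Prop. 3.59] -/
theorem normSq_ricci_chartInv_eq (x₀ : M) (u : chartTarget (𝓡 4) x₀) :
    g.normSq (chartInv (𝓡 4) x₀ u) (g.ricci (chartInv (𝓡 4) x₀ u)) =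
      MetricCoord.normSqAt (chartRep (𝓡 4) (fun _ ↦ g) x₀ 0) u
        (MetricCoord.ricAt (chartRep (𝓡 4) (fun _ ↦ g) x₀ 0) u) := by
  haveI := (chartPullback (𝓡 4) g x₀).hasLeviCivita
  have hG := val_chartPullback_eq_chartRep (fun _ : ℝ ↦ g) x₀ 0
  have h1 : (chartPullback (𝓡 4) g x₀).normSq u ((chartPullback (𝓡 4) g x₀).ricci u) =
      g.normSq (chartInv (𝓡 4) x₀ u) (g.ricci (chartInv (𝓡 4) x₀ u)) :=
    normSq_chartPullback_eq g x₀ u _ _ (fun v w ↦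
      g.ricci_comap_apply contMDiff_pullbackBilin_holds (contMDiff_chartInv x₀)
        (injective_mfderiv_chartInv x₀) rfl u v w)
  rw [← h1]
  exact Lorentzian.OpensChart.normSq_ricci_eq_normSqAt hG u

/-- **Munteanu–Wang 2015, Prop. 1.3 (boundedness of `|Ric|`)**, modulo the registered input `helper_mwShrinkerMaxPrinciple` (the localised maximum principle on
the shrinker, taken as the hypothesis `hS9`): on a complete connected four-dimensional gradient shrinking Ricci soliton
`Ric + Hess f = ½ g`, `R + |∇f|² = f`, with `R ≤ A`, the square norm `|Ric|²_g` is bounded.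
[cite: MunteanuWang2015, Prop. 1.3] -/
theorem normSq_ricci_bounded_of (hg : g.IsRiemannian)
    (hS9 : ∀ (n : ℕ) (M : Type) [TopologicalSpace M] [T2Space M] [SecondCountableTopology M] [ChartedSpace (EuclideanSpace ℝ (Fin n)) M] [IsManifold (𝓡 n) ∞ M] [ConnectedSpace M] [T3Space M] (g : PseudoRiemannianMetric (𝓡 n) ∞ (EuclideanSpace ℝ (Fin n)) (TangentSpace (𝓡 n) : M → Type _)) [g.HasLeviCivita] (f u : M → ℝ) (hg : g.IsRiemannian) (α β r₀ : ℝ), 0 < α → (∀ c : ℝ, IsCompact {y : M | f y ≤ c}) → ContMDiff (𝓡 n) 𝓘(ℝ, ℝ) ∞ f → ContMDiff (𝓡 n) 𝓘(ℝ, ℝ) ∞ u → (∀ (x : M) (X Y : TangentSpace (𝓡 n) x), g.ricci x X Y + g.hessian f x X Y = (1 / 2 : ℝ) * g.val x X Y) → (∀ x : M, g.scalarCurvature x + g.gradSq f x = f x) → (∀ x : M, 0 ≤ g.scalarCurvature x) → (∀ x : M, r₀ ≤ f x → α * u x ^ 2 - β ≤ g.dalembertian u x - g.innerDual x (mvfderiv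 (𝓡 n) f x).toLinearMap (mvfderiv (𝓡 n) u x).toLinearMap) → ∃ C : ℝ, ∀ x : M, u x ≤ C)
    (hc : ∀ (x : M) (r : ℝ≥0), IsCompact {y : M | g.edist hg x y ≤ r})
    (hf : ContMDiff (𝓡 4) 𝓘(ℝ, ℝ) ∞ f)
    (hsol : ∀ (x : M) (X Y : TangentSpace (𝓡 4) x),
      g.ricci x X Y + g.hessian f x X Y = (1 / 2 : ℝ) * g.val x X Y)
    (hnorm : ∀ x : M, g.scalarCurvature x + g.gradSq f x = f x)
    {A : ℝ} (hA : ∀ x : M, g.scalarCurvature x ≤ A) :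
    ∃ C : ℝ, ∀ x : M, g.normSq x (g.ricci x) ≤ C := by
  classical
  have hR0 : ∀ y : M, 0 ≤ g.scalarCurvature y :=
    shrinkerScalarCurvature_nonneg_holds 4 M g f hg hc hf hsol hnorm
  -- WLOG `A ≥ 0`
  set A' : ℝ := max A 0 with hA'def
  have hA'0 : 0 ≤ A' := le_max_right _ _
  have hA' : ∀ y, g.scalarCurvature y ≤ A' := fun y ↦ (hA y).trans (le_max_left _ _)
  -- properness of `f`
  have hK : ∀ c : ℝ, IsCompact {y : M | f y ≤ c} :=
    Shrinker.isCompact_potential_le g hg hc hf hsol hnorm hR0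
  -- the function `u = |Ric|² (S+1)^{-1/2}`
  set u : M → ℝ := fun y ↦ g.normSq y (g.ricci y) * (g.scalarCurvature y + 1) ^ (-(1 / 2 : ℝ))
    with hudef
  have hRic : ContMDiff (𝓡 4) 𝓘(ℝ, ℝ) ∞ fun y ↦ g.normSq y (g.ricci y) := contMDiff_normSq_ricci' g
  have hS : ContMDiff (𝓡 4) 𝓘(ℝ, ℝ) ∞ g.scalarCurvature := contMDiff_scalarCurvature g
  have hu : ContMDiff (𝓡 4) 𝓘(ℝ, ℝ) ∞ u := by
    intro y
    have hpos : g.scalarCurvature y + 1 ≠ 0 := by linarith [hR0 y]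
    have hφ : ContDiffAt ℝ ∞ (fun s : ℝ ↦ (s + 1) ^ (-(1 / 2 : ℝ))) (g.scalarCurvature y) :=
      (contDiffAt_id.add contDiffAt_const).rpow_const_of_ne hpos
    have h2 : ContMDiffAt (𝓡 4) 𝓘(ℝ, ℝ) ∞ (fun z ↦ (g.scalarCurvature z + 1) ^ (-(1 / 2 : ℝ))) y :=
      hφ.contMDiffAt.comp y (hS y)
    exact (hRic y).mul h2
  -- constants
  set α : ℝ := 1 / (8 * Real.sqrt (A' + 1)) with hαdef
  set β : ℝ := 131072 * (A' + 1) ^ 3 with hβdef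
  set r₀ : ℝ := 768 * (A' + 1) + A' with hr₀def
  have hα : 0 < α := by positivity
  -- ### the drift inequality at the points with `f ≥ r₀`, through the chart at the point
  have hdrift : ∀ x : M, r₀ ≤ f x → α * u x ^ 2 - β ≤
      g.dalembertian u x - g.innerDual x (mvfderiv (𝓡 4) f x).toLinearMap
        (mvfderiv (𝓡 4) u x).toLinearMap := by
    intro x hfx
    -- chart data at `x`
    set G := chartRep (𝓡 4) (fun _ ↦ g) x 0 with hGdef
    have hGm : MetricCoord.IsMetricOn G (extChartAt (𝓡 4) x).target :=
      Lorentzian.OpensChart.isMetricOn_repr (val_chartPullback_eq_chartRep (fun _ : ℝ ↦ g) x 0)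
    have hposT : ∀ y ∈ (extChartAt (𝓡 4) x).target, ∀ w : (EuclideanSpace ℝ (Fin 4)), w ≠ 0 → 0 < G y w w := by
      intro y hy w hw
      rw [show y = ((⟨y, hy⟩ : chartTarget (𝓡 4) x) : (EuclideanSpace ℝ (Fin 4))) from rfl, hGdef, chartRep_apply]
      exact chartPullback_pos g x ⟨y, hy⟩ (fun w' hw' ↦ hg _ w' hw') w hw
    set fh : (EuclideanSpace ℝ (Fin 4)) → ℝ := f ∘ (extChartAt (𝓡 4) x).symm with hfhdef
    have hfh : ContDiffOn ℝ ∞ fh (extChartAt (𝓡 4) x).target := by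
      rw [hfhdef, ← contMDiffOn_iff_contDiffOn]
      exact hf.comp_contMDiffOn (contMDiffOn_extChartAt_symm x)
    have hsolc : ∀ y ∈ (extChartAt (𝓡 4) x).target, ∀ v w : (EuclideanSpace ℝ (Fin 4)),
        MetricCoord.ricAt G y v w + MetricCoord.hessAt G fh y v w = (1 / 2 : ℝ) * G y v w :=
      soliton_chartRep_target g x hf hsol
    have hu0 : extChartAt (𝓡 4) x x ∈ (extChartAt (𝓡 4) x).target := mem_extChartAt_target x
    set U₀ : chartTarget (𝓡 4) x := ⟨extChartAt (𝓡 4) x x, hu0⟩ with hU₀def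
    have hΦ : chartInv (𝓡 4) x U₀ = x := extChartAt_to_inv x
    have h4 : finrank ℝ (EuclideanSpace ℝ (Fin 4)) = 4 := finrank_euclideanSpace_fin
    set b : Basis (Fin 4) ℝ (EuclideanSpace ℝ (Fin 4)) := Module.finBasisOfFinrankEq ℝ (EuclideanSpace ℝ (Fin 4)) h4 with hbdef
    -- the two registered inputs at `U₀`
    have hP := (hGm.gradSqAt_mul_rmNormSqAt_le_of_soliton b hu0 h4 (hposT _ hu0) hfh hsolc).2
    have hL := hGm.lapAt_normSqAt_ricAt_sub_fderiv_ge_of_shrinker b hu0 (hposT _ hu0) hfh hsolc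
    -- `S ≤ A'`, `S ≥ 0`, `|∇f|² ≥ 768 (A'+1)` read in the chart
    have hSx : g.scalarCurvature x = MetricCoord.scalAt G (extChartAt (𝓡 4) x x) := by
      have h := Lorentzian.scalarCurvature_chartInv_eq g x U₀
      rwa [hΦ] at h
    have hfd : MDifferentiableAt (𝓡 4) 𝓘(ℝ, ℝ) f (chartInv (𝓡 4) x U₀) := hf.mdifferentiableAt (by simp)
    have hqx : g.gradSq f x = MetricCoord.gradSqAt G fh (extChartAt (𝓡 4) x x) := by
      have h := gradSq_chartInv_eq g x U₀ hfd
      rwa [hΦ] at h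
    have hq : 768 * (A' + 1) ≤ MetricCoord.gradSqAt G fh (extChartAt (𝓡 4) x x) := by
      rw [← hqx]
      have h1 := hnorm x
      have h2 := hA' x
      linarith
    have key := hGm.mw_drift_normSqAt_ricAt_mul_profile hu0 (hposT _ hu0) hfh hsolc b hA'0
      (by rw [← hSx]; exact hA' x) (by rw [← hSx]; exact hR0 x) hq hP hL
    -- ### transport back to the manifold
    -- the representative of `u`
    have hurep : (u ∘ (extChartAt (𝓡 4) x).symm) =ᶠ[𝓝 (U₀ : (EuclideanSpace ℝ (Fin 4)))]
        fun y ↦ MetricCoord.normSqAt G y (MetricCoord.ricAt G y) *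
          (MetricCoord.scalAt G y + 1) ^ (-(1 / 2 : ℝ)) := by
      filter_upwards [(isOpen_extChartAt_target x).mem_nhds hu0] with z hz
      have h1 := normSq_ricci_chartInv_eq g x ⟨z, hz⟩
      have h2 := Lorentzian.scalarCurvature_chartInv_eq g x ⟨z, hz⟩
      simp only [Function.comp_apply, hudef]
      rw [← h1, ← h2]
      rfl
    have hu2 : ContMDiffAt (𝓡 4) 𝓘(ℝ, ℝ) 2 u (chartInv (𝓡 4) x U₀) :=
      ((hu.of_le (WithTop.coe_le_coe.mpr le_top)).contMDiffAt)
    have hud : MDifferentiableAt (𝓡 4) 𝓘(ℝ, ℝ) u (chartInv (𝓡 4) x U₀) :=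
      hu.mdifferentiableAt (by simp)
    -- (a) `Δ u`
    have hlap : g.dalembertian u x = MetricCoord.lapAt G
        (fun y ↦ MetricCoord.normSqAt G y (MetricCoord.ricAt G y) *
          (MetricCoord.scalAt G y + 1) ^ (-(1 / 2 : ℝ))) (extChartAt (𝓡 4) x x) := by
      have h := dalembertian_chartInv_eq g x U₀ hu2
      rw [hΦ] at h
      rw [h]
      exact MetricCoord.lapAt_congr_of_eventuallyEq G hurep
    -- (b) `g⁻¹(df, du)`
    have hi := hGm.isInvertible _ hu0
    have hsG := hGm.symm _ hu0
    have hI : g.innerDual x (mvfderiv (𝓡 4) f x).toLinearMap (mvfderiv (𝓡 4) u x).toLinearMap =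
        fderiv ℝ (fun y ↦ MetricCoord.normSqAt G y (MetricCoord.ricAt G y) *
          (MetricCoord.scalAt G y + 1) ^ (-(1 / 2 : ℝ))) (extChartAt (𝓡 4) x x)
            (MetricCoord.sharpAt G (extChartAt (𝓡 4) x x) (fderiv ℝ fh (extChartAt (𝓡 4) x x))) := by
      have h := innerDual_chartInv_eq g x U₀ hfd hud
      rw [hΦ] at h
      change g.innerDual x (mvfderiv (𝓡 4) f x).toLinearMap (mvfderiv (𝓡 4) u x).toLinearMap = _ at h
      rw [h, hurep.fderiv_eq, ← hfhdef]
      -- symmetry of the pairing `α(♯β) = β(♯α)`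
      set φu := fderiv ℝ (fun y ↦ MetricCoord.normSqAt G y (MetricCoord.ricAt G y) *
          (MetricCoord.scalAt G y + 1) ^ (-(1 / 2 : ℝ))) (extChartAt (𝓡 4) x x)
      rw [← MetricCoord.apply_sharpAt_apply hi φu (MetricCoord.sharpAt G _ (fderiv ℝ fh _)), hsG,
        MetricCoord.apply_sharpAt_apply hi]
    -- (c) the value `u x`
    have hux : u x = MetricCoord.normSqAt G (extChartAt (𝓡 4) x x)
        (MetricCoord.ricAt G (extChartAt (𝓡 4) x x)) *
          (MetricCoord.scalAt G (extChartAt (𝓡 4) x x) + 1) ^ (-(1 / 2 : ℝ)) := by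
      have h := hurep.self_of_nhds
      simp only [Function.comp_apply] at h
      rw [← h]
      congr 1
      exact hΦ.symm
    rw [hlap, hI, hux, hαdef, hβdef]
    have h1 : 1 / (8 * Real.sqrt (A' + 1)) *
        (MetricCoord.normSqAt G (extChartAt (𝓡 4) x x) (MetricCoord.ricAt G (extChartAt (𝓡 4) x x)) *
          (MetricCoord.scalAt G (extChartAt (𝓡 4) x x) + 1) ^ (-(1 / 2 : ℝ))) ^ 2 =
        (MetricCoord.normSqAt G (extChartAt (𝓡 4) x x) (MetricCoord.ricAt G (extChartAt (𝓡 4) x x)) *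
          (MetricCoord.scalAt G (extChartAt (𝓡 4) x x) + 1) ^ (-(1 / 2 : ℝ))) ^ 2 /
            (8 * Real.sqrt (A' + 1)) := by ring
    rw [h1]
    exact key
  -- ### the maximum principle
  obtain ⟨C, hC⟩ := hS9 4 M g f u hg α β r₀ hα hK hf hu hsol hnorm hR0 hdrift
  refine ⟨max C 0 * Real.sqrt (A' + 1), fun x ↦ ?_⟩
  have hσ : 0 < g.scalarCurvature x + 1 := by linarith [hR0 x]
  have hN0 : 0 ≤ g.normSq x (g.ricci x) := g.normSq_nonneg x hg _
  have hcx : (g.scalarCurvature x + 1) ^ (-(1 / 2 : ℝ)) = (Real.sqrt (g.scalarCurvature x + 1))⁻¹ := by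
    rw [Real.sqrt_eq_rpow, ← Real.rpow_neg hσ.le]
  have hsq : 0 < Real.sqrt (g.scalarCurvature x + 1) := Real.sqrt_pos.2 hσ
  have hux : u x = g.normSq x (g.ricci x) * (Real.sqrt (g.scalarCurvature x + 1))⁻¹ := by
    simp only [hudef, hcx]
  have h1 : g.normSq x (g.ricci x) = u x * Real.sqrt (g.scalarCurvature x + 1) := by
    rw [hux, inv_mul_cancel_right₀ hsq.ne']
  have h2 : Real.sqrt (g.scalarCurvature x + 1) ≤ Real.sqrt (A' + 1) :=
    Real.sqrt_le_sqrt (by linarith [hA' x])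
  have h3 : u x ≤ max C 0 := (hC x).trans (le_max_left _ _)
  have h4 : 0 ≤ u x := by rw [hux]; positivity
  rw [h1]
  exact mul_le_mul h3 h2 hsq.le (le_max_right _ _)

omit [T2Space M] [SecondCountableTopology M] [ConnectedSpace M] [T3Space M] [MeasurableSpace M]
  [BorelSpace M] in
/-- **`|Rm|²` read in the chart** at any point of the chart target: `|Rm|²_g(Φ u) = rmNormSqAt G u`
(`curvNormSqWith_chartInv_eq'`). [cite: Topping2006, §3.2, (3.2.4)] -/
theorem curvNormSqWith_chartInv_eq (x₀ : M) (u : chartTarget (𝓡 4) x₀) :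
    g.curvNormSqWith g.leviCivita (chartInv (𝓡 4) x₀ u) =
      MetricCoord.rmNormSqAt (chartRep (𝓡 4) (fun _ ↦ g) x₀ 0) u :=
  curvNormSqWith_chartInv_eq' (PseudoRiemannianMetric.isLeviCivita_leviCivita_holds (g := g)) x₀ u

omit [T2Space M] [SecondCountableTopology M] [ConnectedSpace M] [T3Space M] [MeasurableSpace M]
  [BorelSpace M] in
/-- `|Rm|²_g` is a `C^∞` function on `M` (it is `U_0` of the constant family,
`curvDerivNormSq_zero_eq`, `contMDiffAt_curvDerivNormSq`). [cite: Topping2006, §1.2.3] -/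
theorem contMDiff_curvNormSqWith (hg : g.IsRiemannian) :
    ContMDiff (𝓡 4) 𝓘(ℝ, ℝ) ∞ fun z ↦ g.curvNormSqWith g.leviCivita z := by
  have h : (fun z ↦ g.curvNormSqWith g.leviCivita z) = curvDerivNormSq (𝓡 4) (fun _ ↦ g) 0 0 := by
    funext z
    exact (curvDerivNormSq_zero_eq (g := fun _ ↦ g) (cov := fun _ ↦ g.leviCivita) (t := 0) hg
      (PseudoRiemannianMetric.isLeviCivita_leviCivita_holds (g := g)) z).symm
  rw [h]
  exact fun z ↦ contMDiffAt_curvDerivNormSq (g := fun _ ↦ g) (t := 0) hg 0 z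

/-- **Munteanu–Wang 2015, Thm. 1.4 (boundedness of `|Rm|`)**, modulo the registered inputs
`helper_mwRmNormSqDrift` (`hS5`: `Δ_f|Rm|²` and Kato), `helper_mwShrinkerMaxPrinciple` (`hS9`) and
`helper_mwRmDriftChart` (`hS11`: the pointwise drift inequality for `v = √(|Rm|²+1) + |Ric|²`), and the
Ricci bound `normSq_ricci_bounded_of`: on a complete connected four-dimensional gradient shrinking Ricci
soliton `Ric + Hess f = ½ g`, `R + |∇f|² = f`, with `R ≤ A`, the square norm `|Rm|²_g` is bounded.
[cite: MunteanuWang2015, Thm. 1.4] -/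
theorem curvNormSq_bounded_of (hg : g.IsRiemannian)
    (hS5 : ∃ C : ℝ, ∀ {E : Type} [NormedAddCommGroup E] [NormedSpace ℝ E] [FiniteDimensional ℝ E] [CompleteSpace E] (G : E → E →L[ℝ] E →L[ℝ] ℝ) (V : Set E) (x : E) (f : E → ℝ), MetricCoord.IsMetricOn G V → x ∈ V → Module.finrank ℝ E = 4 → (∀ y ∈ V, ∀ v : E, v ≠ 0 → 0 < G y v v) → ContDiffOn ℝ ∞ f V → (∀ y ∈ V, ∀ v w : E, MetricCoord.ricAt G y v w + MetricCoord.hessAt G f y v w = (1 / 2 : ℝ) * G y v w) → ∃ N : ℝ, 0 ≤ N ∧ 2 * N - C * (Real.sqrt (MetricCoord.rmNormSqAt G x) + 1) * MetricCoord.rmNormSqAt G x ≤ MetricCoord.lapAt G (MetricCoord.rmNormSqAt G) x - fderiv ℝ (MetricCoord.rmNormSqAt G) x (MetricCoord.sharpAt G x (fderiv ℝ f x)) ∧ MetricCoord.gradSqAt G (MetricCoord.rmNormSqAt G) x ≤ 4 * MetricCoord.rmNormSqAt G x * N)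
    (hS9 : ∀ (n : ℕ) (M : Type) [TopologicalSpace M] [T2Space M] [SecondCountableTopology M] [ChartedSpace (EuclideanSpace ℝ (Fin n)) M] [IsManifold (𝓡 n) ∞ M] [ConnectedSpace M] [T3Space M] (g : PseudoRiemannianMetric (𝓡 n) ∞ (EuclideanSpace ℝ (Fin n)) (TangentSpace (𝓡 n) : M → Type _)) [g.HasLeviCivita] (f u : M → ℝ) (hg : g.IsRiemannian) (α β r₀ : ℝ), 0 < α → (∀ c : ℝ, IsCompact {y : M | f y ≤ c}) → ContMDiff (𝓡 n) 𝓘(ℝ, ℝ) ∞ f → ContMDiff (𝓡 n) 𝓘(ℝ, ℝ) ∞ u → (∀ (x : M) (X Y : TangentSpace (𝓡 n) x), g.ricci x X Y + g.hessian f x X Y = (1 / 2 : ℝ) * g.val x X Y) → (∀ x : M, g.scalarCurvature x + g.gradSq f x = f x) → (∀ x : M, 0 ≤ g.scalarCurvature x) → (∀ x : M, r₀ ≤ f x → α * u x ^ 2 - β ≤ g.dalembertian u x - g.innerDual x (mvfderiv (𝓡 n) f x).toLinearMap (mvfderiv (𝓡 n) u x).toLinearMap) → ∃ C : ℝ, ∀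 x : M, u x ≤ C)
    (hS11 : ∀ {E : Type} [NormedAddCommGroup E] [NormedSpace ℝ E] [FiniteDimensional ℝ E] [CompleteSpace E] (G : E → E →L[ℝ] E →L[ℝ] ℝ) (V : Set E) (x : E) (f : E → ℝ) (b : Module.Basis (Fin 4) ℝ E) (C₅ B : ℝ), MetricCoord.IsMetricOn G V → x ∈ V → (∀ v : E, v ≠ 0 → 0 < G x v v) → ContDiffOn ℝ ∞ f V → (∀ y ∈ V, ∀ v w : E, MetricCoord.ricAt G y v w + MetricCoord.hessAt G f y v w = (1 / 2 : ℝ) * G y v w) → 0 ≤ C₅ → 0 ≤ B → MetricCoord.normSqAt G x (MetricCoord.ricAt G x) ≤ B → 32 * (C₅ + 1) ≤ MetricCoord.gradSqAt G f x → MetricCoord.gradSqAt G f x * MetricCoord.rmNormSqAt G x ≤ 16 * MetricCoord.gradSqAt G f x * MetricCoord.normSqAt G x (MetricCoord.ricAt G x) + 64 * ∑ k, ∑ l, MetricCoord.ginv G b x k l * MetricCoord.pairAt G x (MetricCoord.cov₂At G (MetricCoord.ricAt G) x (b k)) (MetricCoord.cov₂At G (MetricCoord.ricAt G) x (b l)) →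 2 * (∑ k, ∑ l, MetricCoord.ginv G b x k l * MetricCoord.pairAt G x (MetricCoord.cov₂At G (MetricCoord.ricAt G) x (b k)) (MetricCoord.cov₂At G (MetricCoord.ricAt G) x (b l))) + 2 * MetricCoord.normSqAt G x (MetricCoord.ricAt G x) - 4 * Real.sqrt (MetricCoord.rmNormSqAt G x) * MetricCoord.normSqAt G x (MetricCoord.ricAt G x) ≤ MetricCoord.lapAt G (fun y ↦ MetricCoord.normSqAt G y (MetricCoord.ricAt G y)) x - fderiv ℝ (fun y ↦ MetricCoord.normSqAt G y (MetricCoord.ricAt G y)) x (MetricCoord.sharpAt G x (fderiv ℝ f x)) → (∃ N : ℝ, 0 ≤ N ∧ 2 * N - C₅ * (Real.sqrt (MetricCoord.rmNormSqAt G x) + 1) * MetricCoord.rmNormSqAt G x ≤ MetricCoord.lapAt G (MetricCoord.rmNormSqAt G) x - fderiv ℝ (MetricCoord.rmNormSqAt G) x (MetricCoord.sharpAt G x (fderiv ℝ f x)) ∧ MetricCoord.gradSqAt G (MetricCoord.rmNormSqAt G) x ≤ 4 * MetricCoord.rmNormSqAt G x * N) → 1 / 4 * ((MetricCoord.rmNormSqAt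 G x + 1) ^ ((1 / 2 : ℝ)) + MetricCoord.normSqAt G x (MetricCoord.ricAt G x)) ^ 2 - ((C₅ + 1) * (16 * B + 1) + 9 * B ^ 2) ≤ MetricCoord.lapAt G (fun y ↦ (MetricCoord.rmNormSqAt G y + 1) ^ ((1 / 2 : ℝ)) + MetricCoord.normSqAt G y (MetricCoord.ricAt G y)) x - fderiv ℝ (fun y ↦ (MetricCoord.rmNormSqAt G y + 1) ^ ((1 / 2 : ℝ)) + MetricCoord.normSqAt G y (MetricCoord.ricAt G y)) x (MetricCoord.sharpAt G x (fderiv ℝ f x)))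
    (hc : ∀ (x : M) (r : ℝ≥0), IsCompact {y : M | g.edist hg x y ≤ r})
    (hf : ContMDiff (𝓡 4) 𝓘(ℝ, ℝ) ∞ f)
    (hsol : ∀ (x : M) (X Y : TangentSpace (𝓡 4) x),
      g.ricci x X Y + g.hessian f x X Y = (1 / 2 : ℝ) * g.val x X Y)
    (hnorm : ∀ x : M, g.scalarCurvature x + g.gradSq f x = f x)
    {A : ℝ} (hA : ∀ x : M, g.scalarCurvature x ≤ A) :
    ∃ C : ℝ, ∀ x : M, g.curvNormSqWith g.leviCivita x ≤ C := by
  classical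
  have hR0 : ∀ y : M, 0 ≤ g.scalarCurvature y :=
    shrinkerScalarCurvature_nonneg_holds 4 M g f hg hc hf hsol hnorm
  -- the Ricci bound
  obtain ⟨B₀, hB₀⟩ := normSq_ricci_bounded_of g f hg hS9 hc hf hsol hnorm hA
  set B : ℝ := max B₀ 0 with hBdef
  have hB0 : 0 ≤ B := le_max_right _ _
  have hB : ∀ y, g.normSq y (g.ricci y) ≤ B := fun y ↦ (hB₀ y).trans (le_max_left _ _)
  -- the constant of the `Rm` equation
  obtain ⟨C₀, hC₀⟩ := hS5
  set C₅ : ℝ := max C₀ 0 with hC₅def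
  have hC₅0 : 0 ≤ C₅ := le_max_right _ _
  -- WLOG `A ≥ 0`
  set A' : ℝ := max A 0 with hA'def
  have hA' : ∀ y, g.scalarCurvature y ≤ A' := fun y ↦ (hA y).trans (le_max_left _ _)
  -- properness of `f`
  have hK : ∀ c : ℝ, IsCompact {y : M | f y ≤ c} :=
    Shrinker.isCompact_potential_le g hg hc hf hsol hnorm hR0
  -- the function `v = √(|Rm|²+1) + |Ric|²`
  set Q : M → ℝ := fun y ↦ g.curvNormSqWith g.leviCivita y with hQdef
  have hQ : ContMDiff (𝓡 4) 𝓘(ℝ, ℝ) ∞ Q := contMDiff_curvNormSqWith g hg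
  have hQ0 : ∀ y, 0 ≤ Q y := fun y ↦
    curvNormSqWith_nonneg hg (PseudoRiemannianMetric.isLeviCivita_leviCivita_holds (g := g)) y
  set v : M → ℝ := fun y ↦ (Q y + 1) ^ ((1 / 2 : ℝ)) + g.normSq y (g.ricci y) with hvdef
  have hRic : ContMDiff (𝓡 4) 𝓘(ℝ, ℝ) ∞ fun y ↦ g.normSq y (g.ricci y) := contMDiff_normSq_ricci' g
  have hv : ContMDiff (𝓡 4) 𝓘(ℝ, ℝ) ∞ v := by
    intro y
    have hpos : Q y + 1 ≠ 0 := by linarith [hQ0 y]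
    have hφ : ContDiffAt ℝ ∞ (fun s : ℝ ↦ (s + 1) ^ ((1 / 2 : ℝ))) (Q y) :=
      (contDiffAt_id.add contDiffAt_const).rpow_const_of_ne hpos
    exact (hφ.contMDiffAt.comp y (hQ y)).add (hRic y)
  -- constants
  set K : ℝ := (C₅ + 1) * (16 * B + 1) + 9 * B ^ 2 with hKdef
  set r₀ : ℝ := 32 * (C₅ + 1) + A' with hr₀def
  -- ### the drift inequality at the points with `f ≥ r₀`, through the chart at the point
  have hdrift : ∀ x : M, r₀ ≤ f x → 1 / 4 * v x ^ 2 - K ≤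
      g.dalembertian v x - g.innerDual x (mvfderiv (𝓡 4) f x).toLinearMap
        (mvfderiv (𝓡 4) v x).toLinearMap := by
    intro x hfx
    -- chart data at `x`
    set G := chartRep (𝓡 4) (fun _ ↦ g) x 0 with hGdef
    have hGm : MetricCoord.IsMetricOn G (extChartAt (𝓡 4) x).target :=
      Lorentzian.OpensChart.isMetricOn_repr (val_chartPullback_eq_chartRep (fun _ : ℝ ↦ g) x 0)
    have hposT : ∀ y ∈ (extChartAt (𝓡 4) x).target, ∀ w : (EuclideanSpace ℝ (Fin 4)), w ≠ 0 → 0 < G y w w := by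
      intro y hy w hw
      rw [show y = ((⟨y, hy⟩ : chartTarget (𝓡 4) x) : (EuclideanSpace ℝ (Fin 4))) from rfl, hGdef, chartRep_apply]
      exact chartPullback_pos g x ⟨y, hy⟩ (fun w' hw' ↦ hg _ w' hw') w hw
    set fh : (EuclideanSpace ℝ (Fin 4)) → ℝ := f ∘ (extChartAt (𝓡 4) x).symm with hfhdef
    have hfh : ContDiffOn ℝ ∞ fh (extChartAt (𝓡 4) x).target := by
      rw [hfhdef, ← contMDiffOn_iff_contDiffOn]
      exact hf.comp_contMDiffOn (contMDiffOn_extChartAt_symm x)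
    have hsolc : ∀ y ∈ (extChartAt (𝓡 4) x).target, ∀ v w : (EuclideanSpace ℝ (Fin 4)),
        MetricCoord.ricAt G y v w + MetricCoord.hessAt G fh y v w = (1 / 2 : ℝ) * G y v w :=
      soliton_chartRep_target g x hf hsol
    have hu0 : extChartAt (𝓡 4) x x ∈ (extChartAt (𝓡 4) x).target := mem_extChartAt_target x
    set U₀ : chartTarget (𝓡 4) x := ⟨extChartAt (𝓡 4) x x, hu0⟩ with hU₀def
    have hΦ : chartInv (𝓡 4) x U₀ = x := extChartAt_to_inv x
    have h4 : finrank ℝ (EuclideanSpace ℝ (Fin 4)) = 4 := finrank_euclideanSpace_fin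
    set b : Basis (Fin 4) ℝ (EuclideanSpace ℝ (Fin 4)) := Module.finBasisOfFinrankEq ℝ (EuclideanSpace ℝ (Fin 4)) h4 with hbdef
    -- the inputs at `U₀`
    have hP := (hGm.gradSqAt_mul_rmNormSqAt_le_of_soliton b hu0 h4 (hposT _ hu0) hfh hsolc).2
    have hL := hGm.lapAt_normSqAt_ricAt_sub_fderiv_ge_of_shrinker b hu0 (hposT _ hu0) hfh hsolc
    have hRm : ∃ N : ℝ, 0 ≤ N ∧ 2 * N - C₅ * (Real.sqrt (MetricCoord.rmNormSqAt G (U₀ : (EuclideanSpace ℝ (Fin 4)))) + 1) *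
        MetricCoord.rmNormSqAt G (U₀ : (EuclideanSpace ℝ (Fin 4))) ≤ MetricCoord.lapAt G (MetricCoord.rmNormSqAt G) (U₀ : (EuclideanSpace ℝ (Fin 4)))
          - fderiv ℝ (MetricCoord.rmNormSqAt G) (U₀ : (EuclideanSpace ℝ (Fin 4))) (MetricCoord.sharpAt G (U₀ : (EuclideanSpace ℝ (Fin 4))) (fderiv ℝ fh (U₀ : (EuclideanSpace ℝ (Fin 4)))))
        ∧ MetricCoord.gradSqAt G (MetricCoord.rmNormSqAt G) (U₀ : (EuclideanSpace ℝ (Fin 4))) ≤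
          4 * MetricCoord.rmNormSqAt G (U₀ : (EuclideanSpace ℝ (Fin 4))) * N := by
      obtain ⟨N, hN0, hN1, hN2⟩ := hC₀ G _ (U₀ : (EuclideanSpace ℝ (Fin 4))) fh hGm hu0 h4 hposT hfh hsolc
      refine ⟨N, hN0, le_trans ?_ hN1, hN2⟩
      obtain ⟨e, he⟩ := MetricCoord.exists_orthonormal_basis (hGm.symm _ hu0) (hposT _ hu0)
      have hM0 : 0 ≤ MetricCoord.rmNormSqAt G (U₀ : (EuclideanSpace ℝ (Fin 4))) := hGm.rmNormSqAt_nonneg e he hu0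
      have h1 : C₀ ≤ C₅ := le_max_left _ _
      have h2 : 0 ≤ (Real.sqrt (MetricCoord.rmNormSqAt G (U₀ : (EuclideanSpace ℝ (Fin 4)))) + 1) * MetricCoord.rmNormSqAt G (U₀ : (EuclideanSpace ℝ (Fin 4))) :=
        by positivity
      nlinarith [mul_le_mul_of_nonneg_right h1 h2]
    -- `|Ric|² ≤ B` and `|∇f|² ≥ 32(C₅+1)` read in the chart
    have hNx : g.normSq x (g.ricci x) = MetricCoord.normSqAt G (extChartAt (𝓡 4) x x)
        (MetricCoord.ricAt G (extChartAt (𝓡 4) x x)) := by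
      have h := normSq_ricci_chartInv_eq g x U₀
      rwa [hΦ] at h
    have hfd : MDifferentiableAt (𝓡 4) 𝓘(ℝ, ℝ) f (chartInv (𝓡 4) x U₀) := hf.mdifferentiableAt (by simp)
    have hqx : g.gradSq f x = MetricCoord.gradSqAt G fh (extChartAt (𝓡 4) x x) := by
      have h := gradSq_chartInv_eq g x U₀ hfd
      rwa [hΦ] at h
    have hq : 32 * (C₅ + 1) ≤ MetricCoord.gradSqAt G fh (extChartAt (𝓡 4) x x) := by
      rw [← hqx]
      have h1 := hnorm x
      have h2 := hA' x
      linarith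
    have key := hS11 G _ (U₀ : (EuclideanSpace ℝ (Fin 4))) fh b C₅ B hGm hu0 (hposT _ hu0) hfh hsolc hC₅0 hB0
      (by rw [← hNx]; exact hB x) hq hP hL hRm
    -- ### transport back to the manifold
    have hvrep : (v ∘ (extChartAt (𝓡 4) x).symm) =ᶠ[𝓝 (U₀ : (EuclideanSpace ℝ (Fin 4)))]
        fun y ↦ (MetricCoord.rmNormSqAt G y + 1) ^ ((1 / 2 : ℝ)) +
          MetricCoord.normSqAt G y (MetricCoord.ricAt G y) := by
      filter_upwards [(isOpen_extChartAt_target x).mem_nhds hu0] with z hz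
      have h1 := normSq_ricci_chartInv_eq g x ⟨z, hz⟩
      have h2 := curvNormSqWith_chartInv_eq g x ⟨z, hz⟩
      simp only [Function.comp_apply, hvdef, hQdef]
      rw [← h1, ← h2]
      rfl
    have hv2 : ContMDiffAt (𝓡 4) 𝓘(ℝ, ℝ) 2 v (chartInv (𝓡 4) x U₀) :=
      ((hv.of_le (WithTop.coe_le_coe.mpr le_top)).contMDiffAt)
    have hvd : MDifferentiableAt (𝓡 4) 𝓘(ℝ, ℝ) v (chartInv (𝓡 4) x U₀) :=
      hv.mdifferentiableAt (by simp)
    have hlap : g.dalembertian v x = MetricCoord.lapAt G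
        (fun y ↦ (MetricCoord.rmNormSqAt G y + 1) ^ ((1 / 2 : ℝ)) +
          MetricCoord.normSqAt G y (MetricCoord.ricAt G y)) (extChartAt (𝓡 4) x x) := by
      have h := dalembertian_chartInv_eq g x U₀ hv2
      rw [hΦ] at h
      rw [h]
      exact MetricCoord.lapAt_congr_of_eventuallyEq G hvrep
    have hi := hGm.isInvertible _ hu0
    have hsG := hGm.symm _ hu0
    have hI : g.innerDual x (mvfderiv (𝓡 4) f x).toLinearMap (mvfderiv (𝓡 4) v x).toLinearMap =
        fderiv ℝ (fun y ↦ (MetricCoord.rmNormSqAt G y + 1) ^ ((1 / 2 : ℝ)) +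
          MetricCoord.normSqAt G y (MetricCoord.ricAt G y)) (extChartAt (𝓡 4) x x)
            (MetricCoord.sharpAt G (extChartAt (𝓡 4) x x) (fderiv ℝ fh (extChartAt (𝓡 4) x x))) := by
      have h := innerDual_chartInv_eq g x U₀ hfd hvd
      rw [hΦ] at h
      change g.innerDual x (mvfderiv (𝓡 4) f x).toLinearMap (mvfderiv (𝓡 4) v x).toLinearMap = _ at h
      rw [h, hvrep.fderiv_eq, ← hfhdef]
      set φv := fderiv ℝ (fun y ↦ (MetricCoord.rmNormSqAt G y + 1) ^ ((1 / 2 : ℝ)) +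
          MetricCoord.normSqAt G y (MetricCoord.ricAt G y)) (extChartAt (𝓡 4) x x)
      rw [← MetricCoord.apply_sharpAt_apply hi φv (MetricCoord.sharpAt G _ (fderiv ℝ fh _)), hsG,
        MetricCoord.apply_sharpAt_apply hi]
    have hvx : v x = (MetricCoord.rmNormSqAt G (extChartAt (𝓡 4) x x) + 1) ^ ((1 / 2 : ℝ)) +
        MetricCoord.normSqAt G (extChartAt (𝓡 4) x x) (MetricCoord.ricAt G (extChartAt (𝓡 4) x x)) := by
      have h := hvrep.self_of_nhds
      simp only [Function.comp_apply] at h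
      rw [← h]
      congr 1
      exact hΦ.symm
    rw [hlap, hI, hvx, hKdef]
    exact key
  -- ### the maximum principle
  obtain ⟨C, hC⟩ := hS9 4 M g f v hg (1 / 4) K r₀ (by norm_num) hK hf hv hsol hnorm hR0 hdrift
  refine ⟨C ^ 2, fun x ↦ ?_⟩
  have hQx : 0 ≤ Q x := hQ0 x
  have hN0 : 0 ≤ g.normSq x (g.ricci x) := g.normSq_nonneg x hg _
  have hρ : (Q x + 1) ^ ((1 / 2 : ℝ)) = Real.sqrt (Q x + 1) := by rw [Real.sqrt_eq_rpow]
  have h1 : Real.sqrt (Q x + 1) ≤ C := by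
    have h := hC x
    simp only [hvdef, hρ] at h
    linarith
  have h2 : Q x + 1 ≤ C ^ 2 := by
    have h3 : 0 ≤ Real.sqrt (Q x + 1) := Real.sqrt_nonneg _
    have h4 := Real.sq_sqrt (by linarith : 0 ≤ Q x + 1)
    nlinarith [mul_le_mul h1 h1 h3 (h3.trans h1)]
  show g.curvNormSqWith g.leviCivita x ≤ C ^ 2
  have : Q x = g.curvNormSqWith g.leviCivita x := rfl
  linarith

end FourShrinker

end Literature.Geometry.Riemannian

end
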